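/-
Copyright (c) 2026. All rights reserved.
Released under Apache 2.0 license as described in the file LICENSE.
Authors: HodgeCM publication cell (pub/hodgecm-mathlib), Track B, seat K2E3-p11 (g4).
-/
import Summits.HodgeConjecture.HodgeConjecture.Theorems.K2E3GLnRichardsonMeasureAdInvariant  -- ★ p857336: `exists_nhds_one_forall_conj_mem` (tube lemma) + its imports (Iwasawa, invariant quotient measure, uniform local constancy)
import Summits.HodgeConjecture.HodgeConjecture.Theorems.K2E3GL3BorelUnipotentHaar            -- ★ (B1) p857423: `isInvInvariant_haar_borelUnipotentGL3`, `exists_homeomorph_conj_diagonal_eq_mul`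
import HarnessLib

/-!
# K2_E3 road (h413), Richardson road (R2-Borel), brick (B2) — the Borel unipotent average `Λ_B(f) = ∫_K ∫_{N₃} f(k u k⁻¹)` of `GL₃(F)` is conjugation invariant

Cell `pub/hodgecm-mathlib` (D-0151), Track B, seat K2E3-p11 (g4) (Richardson road owner; squad bus 2026-09-04T04:37Z).
`--supports stmt-HodgeConjecture-24833 --as helper`; THEOREMS ONLY (no definition ∕ instance ∕ notation ∕ named fact ∕ `sorry`); never imports
`Cruxes/…/Lines`.  COUNT-NEUTRAL.

Purpose.  The REGULAR nilpotent orbit `Ad(GL₃)·J` of `𝔤𝔩₃(F)` is the Richardson orbit of the Borel subgroup `B = T N₃`; its invariant measure is, on the group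
side, the unipotent average `Λ_B(f) = ∫_{K × N₃} f(k u k⁻¹) d(κ ⊗ μ_N)` (`K = GL₃(𝒪)`, `N₃` upper unitriangular).  This file proves
**`GL3.borelUnipotentAverage_comp_conj_eq`: `Λ_B(f ∘ Ad x) = Λ_B(f)`** for every locally constant compactly supported `f` and every `x ∈ GL₃(F)` —
the three-block analogue of ★ `GLn.unipotentAverage_comp_conj_eq` (p857336, two-block parabolics).  Road: at a REGULAR DIAGONAL `t` close to `1`
(§1 `exists_regularDiagonal_mem`) the orbital integral over `G ⧸ T` is, by the tree's Iwasawa formula ★ `exists_integral_descConj_levi_eq_smul` for the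
Borel labelling `c = id : Fin 3 → Fin 3` (`M_id = T`, `U_id = N₃`; its unimodularity hypothesis is ★ (B1) `isInvInvariant_haar_borelUnipotentGL3`) and the
twisted-commutator substitution ★ (B1) `exists_homeomorph_conj_diagonal_eq_mul` (§3), a non-zero multiple of `∫_{K × N₃} f(k (v t) k⁻¹)`, which for `t`
close enough to `1` IS `Λ_B(f)` (§2, tube lemma ★ `exists_nhds_one_forall_conj_mem` + uniform local constancy); the orbital integral is conjugation
invariant (invariant Radon measure on `G ⧸ T`, ★ `exists_smulInvariantMeasure_integral_fiberIntegral_eq`, `T` unimodular ★ `isInvInvariant_haar_standardLeviGL`).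
[Rogawski1990, §4.13 Lemma 4.13.1 and proof p. 70; §8.1 p. 112] [HarishChandra1999AdmissibleDistributions, §3 pp. 8–10 (Deligne–Rao measure of a nilpotent
orbit as a limit of semisimple orbital integrals)] [HarishChandra1970, §I.2].

References: [Rogawski1990] J. D. Rogawski, Ann. of Math. Stud. 123 (1990) · [HarishChandra1999AdmissibleDistributions] Harish-Chandra (DeBacker–Sally), AMS
ULECT 16 (1999) · [HarishChandra1970] Harish-Chandra (notes by G. van Dijk), LNM 162 (1970).
-/

set_option autoImplicit false
set_option linter.dupNamespace false   -- `Summit.HodgeConjecture.HodgeConjecture.…` (D-0017 nested layout; lakefile exemption for Summits)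

noncomputable section

open MeasureTheory MeasureTheory.Measure Filter Topology Set
open scoped MatrixGroups NNReal ENNReal
open Literature.NumberTheory.Automorphic Literature.NumberTheory.Rogawski1990 Literature.MeasureTheory.Group Literature.Topology
open Literature.NumberTheory.GaloisRepresentations Literature.NumberTheory.GaloisRepresentations.IsNonarchimedeanLocalField
open Summit.HodgeConjecture.HodgeConjecture.Cruxes.H413.K2E3GLnRichardsonMeasureAdInvariant (exists_nhds_one_forall_conj_mem)
open Summit.HodgeConjecture.HodgeConjecture.Cruxes.H413.K2E3GL3BorelUnipotentHaar

namespace Summit.HodgeConjecture.HodgeConjecture.Cruxes.H413.K2E3GL3BorelRichardsonMeasureAdInvariant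

/-! ## §1  Regular diagonal elements of `GL₃(F)` close to `1` -/

section Diagonal

variable {F : Type*} [Field F] [TopologicalSpace F]

/-- The diagonal family `w ↦ diag(w₀, w₁, w₂)` (block-diagonal scalars for the Borel labelling `id`) is continuous `(Fin 3 → Fˣ) → GL₃(F)` and sends `1 ↦ 1`.
[folklore] -/
theorem continuous_diagScalar_and_map_one [IsTopologicalRing F] :
    Continuous (fun w : Fin 3 → Fˣ =>
        blockDiagonalGL F (id : Fin 3 → Fin 3) fun a => Matrix.GeneralLinearGroup.scalar {i // id i = a} (w a)) ∧
      (blockDiagonalGL F (id : Fin 3 → Fin 3) fun a => Matrix.GeneralLinearGroup.scalar {i // id i = a} ((1 : Fin 3 → Fˣ) a)) = 1 := by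
  have hsc : ∀ a : Fin 3, Continuous fun m : Fˣ => Matrix.GeneralLinearGroup.scalar {i // id i = a} m := fun a => by
    change Continuous fun m : Fˣ => Units.map ((Matrix.scalar {i // id i = a}).toMonoidHom) m
    refine Continuous.units_map _ ?_
    change Continuous fun r : F => Matrix.scalar {i // id i = a} r
    simp only [Matrix.scalar_apply]
    exact (continuous_pi fun _ => continuous_id).matrix_diagonal
  refine ⟨(continuous_blockDiagonalGL (R := F) (c := (id : Fin 3 → Fin 3))).comp
    (continuous_pi fun a => (hsc a).comp (continuous_apply a)), ?_⟩
  have : (fun a : Fin 3 => Matrix.GeneralLinearGroup.scalar {i // id i = a} ((1 : Fin 3 → Fˣ) a)) = 1 :=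
    funext fun a => by rw [Pi.one_apply, map_one, Pi.one_apply]
  rw [this, map_one]

omit [TopologicalSpace F] in
/-- The block-diagonal scalar `diag(w₀, w₁, w₂)` for the Borel labelling IS the diagonal matrix `diagonal w`. [folklore] -/
theorem coe_diagScalar (w : Fin 3 → Fˣ) :
    ((blockDiagonalGL F (id : Fin 3 → Fin 3) fun a => Matrix.GeneralLinearGroup.scalar {i // id i = a} (w a) : GL (Fin 3) F) :
        Matrix (Fin 3) (Fin 3) F) = Matrix.diagonal fun i => (w i : F) := by
  ext i j
  rw [blockDiagonalGL_apply_coe_dite]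
  by_cases h : i = j
  · subst h
    rw [dif_pos (rfl : id i = id i), Matrix.diagonal_apply_eq, Matrix.GeneralLinearGroup.coe_scalar, Matrix.scalar_apply,
      Matrix.diagonal_apply_eq]
    rfl
  · rw [Matrix.diagonal_apply_ne _ h, dif_neg (show ¬ (id i = id j) from h)]

/-- **Regular diagonal elements near `1`**: every neighbourhood of `1 ∈ GL₃(F)` contains a diagonal `t = diag(1 + x₀, 1 + x₁, 1 + x₂)` with PAIRWISE DISTINCT
entries (`‖x_k‖ = q^{-R-k}`, all in the unit filtrations pulled back from the neighbourhood; ★ `exists_unitFiltration_subset`, ★ `exists_normAbs_eq_inv_zpow_of_int`).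
[cite: Rogawski1990, §8.1 p. 112] -/
theorem exists_regularDiagonal_mem [ValuativeRel F] [IsNonarchimedeanLocalField F] {W : Set (GL (Fin 3) F)} (hW : W ∈ 𝓝 (1 : GL (Fin 3) F)) :
    ∃ w : Fin 3 → Fˣ, (∀ a b : Fin 3, a ≠ b → (w a : F) ≠ w b) ∧
      (blockDiagonalGL F (id : Fin 3 → Fin 3) fun a => Matrix.GeneralLinearGroup.scalar {i // id i = a} (w a)) ∈ W := by
  haveI : IsTopologicalRing F := inferInstance
  obtain ⟨hcont, h1⟩ := continuous_diagScalar_and_map_one (F := F)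
  have hW' : (fun w : Fin 3 → Fˣ =>
      blockDiagonalGL F (id : Fin 3 → Fin 3) fun a => Matrix.GeneralLinearGroup.scalar {i // id i = a} (w a)) ⁻¹' W ∈ 𝓝 (1 : Fin 3 → Fˣ) := by
    refine hcont.continuousAt.preimage_mem_nhds ?_
    rw [show (blockDiagonalGL F (id : Fin 3 → Fin 3) fun a => Matrix.GeneralLinearGroup.scalar {i // id i = a} ((1 : Fin 3 → Fˣ) a)) = 1 from h1]
    exact hW
  rw [nhds_pi, Filter.mem_pi] at hW'
  obtain ⟨I, -, V, hV, hVW⟩ := hW'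
  have hfil : ∀ a : Fin 3, ∃ n : ℕ, 1 ≤ n ∧ unitFiltration F n ⊆ V a := fun a => exists_unitFiltration_subset (hV a)
  choose r hr1 hrV using hfil
  have hex : ∀ k : Fin 3, ∃ x : F, x ≠ 0 ∧ normAbs F x = (residueFieldCard F : ℝ≥0)⁻¹ ^ (((r 0 + r 1 + r 2 + k : ℕ)) : ℤ) := fun k =>
    exists_normAbs_eq_inv_zpow_of_int (F := F) _
  choose x hx0 hx using hex
  have hq0 := inv_residueFieldCard_pos (F := F)
  have hq1 := inv_residueFieldCard_lt_one (F := F)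
  have hlt : ∀ k, normAbs F (x k) < 1 := fun k => by
    rw [hx k, zpow_natCast]
    exact pow_lt_one₀ hq0.le hq1 (by have := hr1 0; omega)
  have hne : ∀ k, (1 : F) + x k ≠ 0 := fun k h => by
    have hx1 : x k = -1 := eq_neg_of_add_eq_zero_right h
    have := hlt k
    rw [hx1, normAbs_neg, map_one] at this
    exact lt_irrefl _ this
  refine ⟨fun k => Units.mk0 (1 + x k) (hne k), fun a b hab h => hab ?_, hVW fun a _ => hrV a ?_⟩
  · -- distinct norms ⇒ distinct entries
    rw [Units.val_mk0, Units.val_mk0] at h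
    have hn := congrArg (normAbs F) (add_left_cancel h)
    rw [hx a, hx b] at hn
    have hint := zpow_right_injective₀ hq0 hq1.ne hn
    exact Fin.ext (by push_cast at hint; omega)
  · rw [mem_unitFiltration_iff_sub_one_mem (hr1 a)]
    show ((Units.mk0 (1 + x a) (hne a) : Fˣ) : F) - 1 ∈ primePowBall F (r a : ℤ)
    rw [Units.val_mk0, add_sub_cancel_left, mem_primePowBall_iff, hx a]
    exact zpow_le_zpow_right_of_le_one₀ hq0 hq1.le (by fin_cases a <;> push_cast <;> omega)

end Diagonal

/-! ## §2  The average at `v t`, `t` close to `1`, equals the average at `v` -/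

section Average

variable {F : Type*} [Field F] {n : ℕ} {α : Type*} [LinearOrder α] {c : Fin n → α} [MeasurableSpace (GL (Fin n) F)]
  {E : Type*} [NormedAddCommGroup E] [NormedSpace ℝ E]

/-- **`∫_{K×U} f(k (u z) k⁻¹) = ∫_{K×U} f(k u k⁻¹)`** as soon as `f (g v) = f g` for all `g` and all `v ∈ V` with `k z k⁻¹ ∈ V` for every `k ∈ K`:
`k (u z) k⁻¹ = (k u k⁻¹)(k z k⁻¹)` — any block labelling `c` (★ `unipotentAverage_at_eq` is the two-block case). [cite: Rogawski1990, §8.1 p. 112] -/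
theorem unipotentAverage_mul_at_eq [ValuativeRel F] [TopologicalSpace F] (κ : Measure ↥(glInt n F)) (μN : Measure ↥(unipotentRadicalGL F c))
    {f : GL (Fin n) F → E} {V : Set (GL (Fin n) F)} (hfV : ∀ g, ∀ v ∈ V, f (g * v) = f g)
    {z : GL (Fin n) F} (hz : ∀ k : GL (Fin n) F, k ∈ glInt n F → k * z * k⁻¹ ∈ V) :
    ∫ q : ↥(glInt n F) × ↥(unipotentRadicalGL F c), f ((q.1 : GL (Fin n) F) * ((q.2 : GL (Fin n) F) * z) * (q.1 : GL (Fin n) F)⁻¹) ∂(κ.prod μN) =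
      ∫ q : ↥(glInt n F) × ↥(unipotentRadicalGL F c), f ((q.1 : GL (Fin n) F) * (q.2 : GL (Fin n) F) * (q.1 : GL (Fin n) F)⁻¹) ∂(κ.prod μN) := by
  refine integral_congr_ae (Eventually.of_forall fun q => ?_)
  have h : (q.1 : GL (Fin n) F) * ((q.2 : GL (Fin n) F) * z) * (q.1 : GL (Fin n) F)⁻¹ =
      ((q.1 : GL (Fin n) F) * (q.2 : GL (Fin n) F) * (q.1 : GL (Fin n) F)⁻¹) * ((q.1 : GL (Fin n) F) * z * (q.1 : GL (Fin n) F)⁻¹) := by group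
  simp only [h]
  exact hfV _ _ (hz _ q.1.2)

end Average

/-! ## §3  The twisted-commutator substitution on `K × N₃` -/

section Substitution

variable {F : Type*} [Field F] [ValuativeRel F] [TopologicalSpace F] [IsNonarchimedeanLocalField F]
  [MeasurableSpace F] [BorelSpace F] [MeasurableSpace (GL (Fin 3) F)] [BorelSpace (GL (Fin 3) F)]
  {E : Type*} [NormedAddCommGroup E] [NormedSpace ℝ E]

/-- **`∫_{K×N₃} f((k u) t (k u)⁻¹) = c ∫_{K×N₃} f(k (v t) k⁻¹)`, `c ≠ 0`**, at a regular diagonal `t = diag(d)`: `(k u) t (k u)⁻¹ = k (ψ(u) t) k⁻¹` with the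
homeomorphism `ψ` of ★ (B1) `exists_homeomorph_conj_diagonal_eq_mul`, and `(id × ψ)_* (κ ⊗ μ_N) = c • (κ ⊗ μ_N)`.  No measurability hypothesis on `f`.
[cite: Rogawski1990, §4.13, proof of Lemma 4.13.1, p. 70] -/
theorem exists_integral_prod_conj_diagonal_eq_smul (κ : Measure ↥(glInt 3 F)) [SFinite κ]
    (μN : Measure ↥(unipotentRadicalGL F (id : Fin 3 → Fin 3))) [IsHaarMeasure μN]
    (t : GL (Fin 3) F) (d : Fin 3 → F) (ht : (t : Matrix (Fin 3) (Fin 3) F) = Matrix.diagonal d)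
    (h01 : d 0 ≠ d 1) (h12 : d 1 ≠ d 2) (h02 : d 0 ≠ d 2) :
    ∃ c : ℝ≥0, c ≠ 0 ∧ ∀ f : GL (Fin 3) F → E,
      ∫ q : ↥(glInt 3 F) × ↥(unipotentRadicalGL F (id : Fin 3 → Fin 3)),
          f ((q.1 : GL (Fin 3) F) * (q.2 : GL (Fin 3) F) * t * ((q.1 : GL (Fin 3) F) * (q.2 : GL (Fin 3) F))⁻¹) ∂(κ.prod μN) =
        c • ∫ q : ↥(glInt 3 F) × ↥(unipotentRadicalGL F (id : Fin 3 → Fin 3)),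
          f ((q.1 : GL (Fin 3) F) * ((q.2 : GL (Fin 3) F) * t) * (q.1 : GL (Fin 3) F)⁻¹) ∂(κ.prod μN) := by
  haveI : T2Space F := (isLocalField F).toT2Space
  haveI : LocallyCompactSpace F := (isLocalField F).toLocallyCompactSpace
  haveI : SecondCountableTopology F := secondCountableTopology_localField F
  haveI : IsTopologicalRing F := inferInstance
  haveI : BorelSpace ↥(unipotentRadicalGL F (id : Fin 3 → Fin 3)) := Subtype.borelSpace _
  haveI : BorelSpace ↥(glInt 3 F) := Subtype.borelSpace _
  obtain ⟨e, -⟩ := exists_coordHomeomorph (R := F)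
  haveI : SecondCountableTopology ↥(unipotentRadicalGL F (id : Fin 3 → Fin 3)) := e.symm.secondCountableTopology
  haveI : LocallyCompactSpace ↥(unipotentRadicalGL F (id : Fin 3 → Fin 3)) := e.symm.isClosedEmbedding.locallyCompactSpace
  haveI : SFinite μN := inferInstance
  obtain ⟨ψ, hψ, c, hc, hμ⟩ := exists_homeomorph_conj_diagonal_eq_mul t d ht h01 h12 h02 μN
  refine ⟨c, hc, fun f => ?_⟩
  have hrw : ∀ q : ↥(glInt 3 F) × ↥(unipotentRadicalGL F (id : Fin 3 → Fin 3)),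
      (q.1 : GL (Fin 3) F) * (q.2 : GL (Fin 3) F) * t * ((q.1 : GL (Fin 3) F) * (q.2 : GL (Fin 3) F))⁻¹ =
        (q.1 : GL (Fin 3) F) * (((ψ q.2 : ↥(unipotentRadicalGL F (id : Fin 3 → Fin 3))) : GL (Fin 3) F) * t) * (q.1 : GL (Fin 3) F)⁻¹ := fun q => by
    rw [← hψ q.2]; group
  simp_rw [hrw]
  -- substitute `v = ψ(u)`: `(id × ψ)_* (κ ⊗ μN) = κ ⊗ ψ_* μN = c • (κ ⊗ μN)`
  have hemb : MeasurableEmbedding (Prod.map (id : ↥(glInt 3 F) → ↥(glInt 3 F)) ψ) :=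
    ((MeasurableEquiv.refl ↥(glInt 3 F)).prodCongr ψ.toMeasurableEquiv).measurableEmbedding
  have hmap : (κ.prod μN).map (Prod.map (id : ↥(glInt 3 F) → ↥(glInt 3 F)) ψ) = c • κ.prod μN := by
    rw [← Measure.map_prod_map _ _ measurable_id ψ.continuous.measurable, Measure.map_id, hμ, Measure.prod_smul_right]
  have key := hemb.integral_map (μ := κ.prod μN)
    (fun q : ↥(glInt 3 F) × ↥(unipotentRadicalGL F (id : Fin 3 → Fin 3)) =>
      f ((q.1 : GL (Fin 3) F) * ((q.2 : GL (Fin 3) F) * t) * (q.1 : GL (Fin 3) F)⁻¹))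
  rw [hmap, integral_smul_nnreal_measure] at key
  simpa only [Prod.map_fst, Prod.map_snd, id_eq] using key.symm

end Substitution

/-! ## §4  The Borel (three-block) Richardson unipotent average of `GL₃(F)` is conjugation invariant -/

section Main

variable {F : Type*} [Field F] [ValuativeRel F] [TopologicalSpace F] [IsNonarchimedeanLocalField F]
  [MeasurableSpace F] [BorelSpace F] [MeasurableSpace (GL (Fin 3) F)] [BorelSpace (GL (Fin 3) F)]

/-- **(R2-Borel), GROUP SIDE: `Λ_B(f ∘ Ad x) = Λ_B(f)` on `GL₃(F)`.**  For Haar measures `κ` on `K = GL₃(𝒪)` and `μ_N` on the upper unitriangular group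
`N₃ = U_id`, every locally constant compactly supported `f : GL₃(F) → ℂ` and every `x ∈ GL₃(F)`:
`∫_{K×N₃} f(x (k u k⁻¹) x⁻¹) d(κ ⊗ μ_N) = ∫_{K×N₃} f(k u k⁻¹) d(κ ⊗ μ_N)` — the Richardson (Deligne–Rao) unipotent orbital integral attached to the BOREL
subgroup (whose Richardson orbit is the REGULAR unipotent ∕ nilpotent orbit) is an invariant distribution.  Proof: Iwasawa over `G ⧸ T` at a regular diagonal
`t` close to `1` (§1–§3) and the conjugation invariance of the orbital integral over `G ⧸ T`.
[cite: Rogawski1990, §4.13 Lemma 4.13.1 (a), proof p. 70; §8.1 p. 112] [cite: HarishChandra1999AdmissibleDistributions, §3 p. 9] -/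
theorem GL3.borelUnipotentAverage_comp_conj_eq
    (κ : Measure ↥(glInt 3 F)) [IsHaarMeasure κ] (μN : Measure ↥(unipotentRadicalGL F (id : Fin 3 → Fin 3))) [IsHaarMeasure μN]
    {f : GL (Fin 3) F → ℂ} (hlc : IsLocallyConstant f) (hcs : HasCompactSupport f) (x : GL (Fin 3) F) :
    ∫ q : ↥(glInt 3 F) × ↥(unipotentRadicalGL F (id : Fin 3 → Fin 3)),
        f (x * ((q.1 : GL (Fin 3) F) * (q.2 : GL (Fin 3) F) * (q.1 : GL (Fin 3) F)⁻¹) * x⁻¹) ∂(κ.prod μN) =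
      ∫ q : ↥(glInt 3 F) × ↥(unipotentRadicalGL F (id : Fin 3 → Fin 3)),
        f ((q.1 : GL (Fin 3) F) * (q.2 : GL (Fin 3) F) * (q.1 : GL (Fin 3) F)⁻¹) ∂(κ.prod μN) := by
  classical
  haveI : T2Space F := (isLocalField F).toT2Space
  haveI : LocallyCompactSpace F := (isLocalField F).toLocallyCompactSpace
  haveI : SecondCountableTopology F := secondCountableTopology_localField F
  haveI : T2Space (GL (Fin 3) F) := t2Space_generalLinearGroup F 3
  haveI : LocallyCompactSpace (GL (Fin 3) F) := locallyCompactSpace_generalLinearGroup F 3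
  haveI : SecondCountableTopology (GL (Fin 3) F) := by
    haveI : SecondCountableTopology (Matrix (Fin 3) (Fin 3) F) := inferInstanceAs (SecondCountableTopology (Fin 3 → Fin 3 → F))
    haveI : SecondCountableTopology (Matrix (Fin 3) (Fin 3) F)ᵐᵒᵖ := MulOpposite.opHomeomorph.symm.secondCountableTopology
    exact Units.isEmbedding_embedProduct.secondCountableTopology
  haveI : BorelSpace ↥(unipotentRadicalGL F (id : Fin 3 → Fin 3)) := Subtype.borelSpace _
  haveI : BorelSpace ↥(glInt 3 F) := Subtype.borelSpace _
  haveI : CompactSpace ↥(glInt 3 F) := isCompact_iff_compactSpace.1 (isCompact_glInt 3 F)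
  haveI : IsFiniteMeasure κ := CompactSpace.isFiniteMeasure
  -- `f ∘ Ad x` is again locally constant with compact support
  set f' : GL (Fin 3) F → ℂ := fun g => f (x * g * x⁻¹) with hf'
  have hsm' : IsLocSmooth f' := isLocSmooth_comp_conj (⟨hlc, hcs⟩ : IsLocSmooth f) x
  -- §1: a common right-invariance neighbourhood `V`, the tube `W`, a regular diagonal `t ∈ W`
  obtain ⟨V₁, hV₁, hfV₁⟩ := exists_nhds_one_forall_mul_eq_of_hasCompactSupport hlc hcs
  obtain ⟨V₂, hV₂, hfV₂⟩ := exists_nhds_one_forall_mul_eq_of_hasCompactSupport hsm'.1 hsm'.2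
  obtain ⟨W, hW, hWV⟩ := exists_nhds_one_forall_conj_mem (G := GL (Fin 3) F) (isCompact_glInt 3 F) (Filter.inter_mem hV₁ hV₂)
  obtain ⟨w, hw, htW⟩ := exists_regularDiagonal_mem (F := F) hW
  set t : GL (Fin 3) F := blockDiagonalGL F (id : Fin 3 → Fin 3) fun a => Matrix.GeneralLinearGroup.scalar {i // id i = a} (w a) with htdef
  have ht : (t : Matrix (Fin 3) (Fin 3) F) = Matrix.diagonal fun i => (w i : F) := coe_diagScalar w
  have hz₁ : ∀ k : GL (Fin 3) F, k ∈ glInt 3 F → k * t * k⁻¹ ∈ V₁ := fun k hk => (hWV t htW k hk).1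
  have hz₂ : ∀ k : GL (Fin 3) F, k ∈ glInt 3 F → k * t * k⁻¹ ∈ V₂ := fun k hk => (hWV t htW k hk).2
  -- `A = T = C_G(t)`, an invariant Radon measure on `G ⧸ A`
  set A : Subgroup (GL (Fin 3) F) := standardLeviGL F (id : Fin 3 → Fin 3) with hA
  have hAcl : IsClosed ((A : Subgroup (GL (Fin 3) F)) : Set (GL (Fin 3) F)) := isClosed_standardLeviGL (R := F) (id : Fin 3 → Fin 3)
  letI : MeasurableSpace (GL (Fin 3) F ⧸ A) := borel _
  haveI : BorelSpace (GL (Fin 3) F ⧸ A) := ⟨rfl⟩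
  haveI : BorelSpace ↥A := Subtype.borelSpace _
  haveI : LocallyCompactSpace ↥A := hAcl.locallyCompactSpace
  haveI : SecondCountableTopology ↥A := TopologicalSpace.Subtype.secondCountableTopology _
  haveI : (haar : Measure ↥A).IsInvInvariant := isInvInvariant_haar_standardLeviGL F (id : Fin 3 → Fin 3) haar
  haveI : (haar : Measure (GL (Fin 3) F)).IsMulRightInvariant := isMulRightInvariant_generalLinearGroup _
  obtain ⟨μq, hμinv, hμreg, hμ0, -⟩ :=
    exists_smulInvariantMeasure_integral_fiberIntegral_eq A (haar : Measure ↥A) hAcl (haar : Measure (GL (Fin 3) F))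
  haveI := hμinv
  haveI := hμreg
  -- the regular diagonal `t` is centralised exactly by `A = T`
  have hcentral : Subgroup.centralizer ({t} : Set (GL (Fin 3) F)) = A := by
    rw [htdef, hA]
    exact centralizer_blockDiagonalGL_scalar_eq_standardLeviGL (R := F) (id : Fin 3 → Fin 3) w fun a b hab =>
      (sub_ne_zero.2 (hw a b hab)).isUnit
  have hzA : ∀ a ∈ A, a * t = t * a := fun a ha => by
    rw [← hcentral] at ha
    exact Subgroup.mem_centralizer_singleton_iff.1 ha
  -- `N₃` is unimodular (★ (B1)): the hypothesis of the Iwasawa formula for `c = id`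
  haveI : μN.IsInvInvariant := isInvInvariant_haar_borelUnipotentGL3 μN
  -- ★ Iwasawa over `G ⧸ T`, for `f` and for `f'`
  obtain ⟨C, hC0, hC⟩ := exists_integral_descConj_levi_eq_smul F (c := (id : Fin 3 → Fin 3)) monotone_id (A := A) hA μq hμ0 κ μN (E := ℂ)
  have e1 := hC t hzA f hlc.continuous
  have e2 := hC t hzA f' hsm'.1.continuous
  -- conjugation invariance of the orbital integral over `G ⧸ A`
  have hinv : ∫ y, descConj t A hzA f' y ∂μq = ∫ y, descConj t A hzA f y ∂μq := by
    have h1 : ∀ y, descConj t A hzA f' y = descConj t A hzA f (x • y) := fun y => by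
      induction y using QuotientGroup.induction_on with
      | H g =>
        rw [MulAction.Quotient.smul_mk, descConj_mk, descConj_mk, smul_eq_mul]
        simp only [hf']
        congr 1
        group
    simp_rw [h1]
    exact integral_smul_eq_self _
  rw [e1, e2] at hinv
  -- §3: the twisted-commutator substitution, then §2: the averages at `v t` are the averages at `v`
  obtain ⟨c, hc0, hsub⟩ := exists_integral_prod_conj_diagonal_eq_smul (E := ℂ) κ μN t (fun i => (w i : F)) ht (hw 0 1 (by decide)) (hw 1 2 (by decide))
    (hw 0 2 (by decide))
  rw [hsub f, hsub f', unipotentAverage_mul_at_eq κ μN hfV₂ hz₂, unipotentAverage_mul_at_eq κ μN hfV₁ hz₁] at hinv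
  -- cancel the non-zero scalar `C c`
  simp only [smul_smul] at hinv
  have key : ∀ {r : ℝ≥0} {a b : ℂ}, r • a = r • b → r ≠ 0 → a = b := fun {r a b} h hr => by
    rw [NNReal.smul_def, NNReal.smul_def] at h
    exact smul_right_injective ℂ (NNReal.coe_ne_zero.2 hr) h
  have hcancel := key hinv (mul_ne_zero hC0 hc0)
  simpa only [hf', mul_assoc] using hcancel

end Main

end Summit.HodgeConjecture.HodgeConjecture.Cruxes.H413.K2E3GL3BorelRichardsonMeasureAdInvariant

end
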